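import Mathlib
import Literature.NumberTheory.Automorphic.CongruenceSubgroupPropertySL2

/-!
# Crux `HilbertIntegralOverconvergentIsCongruence` (stmt-Langlands-8485), line `Sketch-ideate-r1-k1`:
# the TRANSFER half — Serre's congruence subgroup property (named fact) and the group-theoretic
# core of "algebraic over the Hilbert modular function field ⇒ congruence-invariant"

The line's transfer (`Ideas/csp-koecher-collapse.md`): if the standard-cusp `q`-expansion `g` of an
overconvergent Hilbert modular form over a totally real `F`, `[F:ℚ] ≥ 2`, is ALGEBRAIC over the Hilbert
modular function field `K`, then `SL₂(𝓞_F)` — acting on the field `L` of meromorphic functions by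
`K`-automorphisms — permutes the finitely many roots of the minimal polynomial of `g`, so `Stab(g)` has
finite index, hence (Serre's CSP for `SL₂` over `𝓞_F`, `F` totally real of degree `≥ 2`) contains a
principal congruence subgroup `Γ(𝔪)`, `𝔪 ≠ 0`; Götzky–Koecher then makes `g` classical.  This file
uses the one published input as the Literature NAMED FACT
`Literature.NumberTheory.Automorphic.SerreSL2Congruence1970_congruenceSubgroupProperty` (Serre 1970
Thm 2 + Cor.; filed from this line, p107956) and proves the
group-theoretic core in full generality: for ANY action of `SL₂(𝓞_F)` on a field `L` by automorphisms
over a subfield `K`, every `x ∈ L` algebraic over `K` is fixed by some principal congruence subgroup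
(`exists_principalCongruence_fixing_of_isAlgebraic`).  The Koecher step needs Hilbert-modular-form
vocabulary (definition request `HilbertModularFormQExpansion`) and is not typable yet.
-/

set_option linter.dupNamespace false -- mandated namespace `Summit.Langlands.Langlands.…` repeats a component

namespace Summit.Langlands.Langlands.Theorems.HilbertIntegralOverconvergentIsCongruence

open scoped NumberField

/-- **Algebraic elements are fixed by a principal congruence subgroup** (the group-theoretic core of
the transfer, conditional on Serre's CSP by name).  Let `F` be totally real of degree `≥ 2` and let
`SL₂(𝓞_F)` act on a field `L` by ring automorphisms commuting with the scalars of a subfield `K`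
(i.e. by `K`-algebra automorphisms).  If `x ∈ L` is algebraic over `K`, then for some non-zero ideal
`𝔪 ⊆ 𝓞_F` every `γ ≡ 1 (mod 𝔪)` in `SL₂(𝓞_F)` fixes `x`.  Proof: the orbit of `x` lies in the finite
root set of its minimal polynomial, so the stabiliser has finite index (orbit–stabiliser), and CSP puts
a `Γ(𝔪)` inside it. -/
theorem exists_principalCongruence_fixing_of_isAlgebraic
    (hCSP : Literature.NumberTheory.Automorphic.SerreSL2Congruence1970_congruenceSubgroupProperty)
    (F : Type) [Field F] [NumberField F] [NumberField.IsTotallyReal F]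
    (hd : 1 < Module.finrank ℚ F) {K L : Type*} [Field K] [Field L] [Algebra K L]
    [MulSemiringAction (Matrix.SpecialLinearGroup (Fin 2) (𝓞 F)) L]
    [SMulCommClass (Matrix.SpecialLinearGroup (Fin 2) (𝓞 F)) K L] (x : L) (hx : IsAlgebraic K x) :
    ∃ 𝔪 : Ideal (𝓞 F), 𝔪 ≠ ⊥ ∧
      ∀ γ ∈ (Matrix.SpecialLinearGroup.map (n := Fin 2) (Ideal.Quotient.mk 𝔪)).ker, γ • x = x := by
  set G := Matrix.SpecialLinearGroup (Fin 2) (𝓞 F)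
  -- the orbit lies in the root set of the minimal polynomial, hence is finite
  have horbit : (MulAction.orbit G x).Finite := by
    refine (Polynomial.rootSet_finite (minpoly K x) L).subset ?_
    rintro _ ⟨g, rfl⟩
    rw [Polynomial.mem_rootSet_of_ne (minpoly.ne_zero hx.isIntegral)]
    have h := minpoly.aeval K x
    apply_fun (MulSemiringAction.toAlgEquiv K L g) at h
    rwa [map_zero, ← Polynomial.aeval_algHom_apply] at h
  -- so the stabiliser has finite index
  have hfi : (MulAction.stabilizer G x).FiniteIndex := by
    rw [Subgroup.finiteIndex_iff, MulAction.index_stabilizer]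
    exact ((Set.ncard_pos horbit).mpr ⟨x, MulAction.mem_orbit_self x⟩).ne'
  -- CSP: it contains a principal congruence subgroup
  obtain ⟨𝔪, h𝔪, hle⟩ := hCSP F hd (MulAction.stabilizer G x) hfi
  exact ⟨𝔪, h𝔪, fun γ hγ ↦ MulAction.mem_stabilizer_iff.mp (hle hγ)⟩

/-- **Registered shape of stub 10 (`stub_transferCore`) of line `Sketch-ideate-r1-k1`**: Serre's CSP
(unfolded, as hypothesis) ⇒ algebraic elements of any `SL₂(𝓞_F)`-field over the fixed subfield are
fixed by a principal congruence subgroup.  Immediate from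
`exists_principalCongruence_fixing_of_isAlgebraic`. -/
theorem stub_transferCore :
    (∀ (F : Type) [Field F] [NumberField F] [NumberField.IsTotallyReal F],
      1 < Module.finrank ℚ F →
      ∀ H : Subgroup (Matrix.SpecialLinearGroup (Fin 2) (NumberField.RingOfIntegers F)),
        H.FiniteIndex →
        ∃ 𝔪 : Ideal (NumberField.RingOfIntegers F), 𝔪 ≠ ⊥ ∧
          (Matrix.SpecialLinearGroup.map (Ideal.Quotient.mk 𝔪)).ker ≤ H) →
    ∀ (F : Type) [Field F] [NumberField F] [NumberField.IsTotallyReal F],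
      1 < Module.finrank ℚ F →
      ∀ (K L : Type) [Field K] [Field L] [Algebra K L]
        [MulSemiringAction (Matrix.SpecialLinearGroup (Fin 2) (NumberField.RingOfIntegers F)) L]
        [SMulCommClass (Matrix.SpecialLinearGroup (Fin 2) (NumberField.RingOfIntegers F)) K L]
        (x : L), IsAlgebraic K x →
        ∃ 𝔪 : Ideal (NumberField.RingOfIntegers F), 𝔪 ≠ ⊥ ∧
          (Matrix.SpecialLinearGroup.map (Ideal.Quotient.mk 𝔪)).ker ≤
            MulAction.stabilizer (Matrix.SpecialLinearGroup (Fin 2) (NumberField.RingOfIntegers F)) x :=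
  fun hCSP F _ _ _ hd _ _ _ _ _ _ _ x hx ↦ by
    obtain ⟨𝔪, h𝔪, h⟩ := exists_principalCongruence_fixing_of_isAlgebraic hCSP F hd x hx
    exact ⟨𝔪, h𝔪, fun γ hγ ↦ MulAction.mem_stabilizer_iff.mpr (h γ hγ)⟩

end Summit.Langlands.Langlands.Theorems.HilbertIntegralOverconvergentIsCongruence
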